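import Mathlib

/-!
# Sketch — crux idea `smoothing-coboundary` for `SignedMuSeedAtTwoPlus` (stmt-BirchSwinnertonDyer-21438)

First lemmas of the line, abstract form (pure algebra, no geometry):

* `CoboundaryLaw` — a twisted-symmetric scalar 1-cocycle `f (a * b) = f b + η b * f a` of a commutative
  monoid is the coboundary `f a = κ * (η a - 1)` as soon as one `η b₀ - 1` is a unit (PROVED below).
  Geometric instance (level 0 of the 𝔩-smoothed elliptic-unit jets on the tilt curve `y² + y = x³`):
  `f(α) = Σ_c χ̄₀(c)·(D log ψ_α)(x([c]Q̃))`, `η = ω̃·χ₀`, giving `E₀(χ; 𝔩) = κ_χ · (1 + η(π_𝔩))`.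
* `OperatorCoboundaryLaw` — the all-order version with a commuting family of linear operators
  `ρ a` (geometrically `ρ a = [a]^*` on `k⟦T⟧`): `F (a*b) = F b + η b • ρ b (F a)` and one
  `η b₀ • ρ b₀ - 1` invertible ⟹ `F a = η a • ρ a G - G` for a single class vector `G` (PROVED below).

BSD is not proved by any of this; these are the abstract skeleton lemmas an eventual line would cite.
-/

namespace Summit.BirchSwinnertonDyer.BirchSwinnertonDyer.Cruxes.SignedMuSeedAtTwoPlus.SmoothingCoboundary

/-- Scalar coboundary law: a twisted-symmetric 1-cocycle of a commutative monoid into a commutative ring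
is a coboundary once `η b₀ - 1` is a unit for one `b₀`. -/
def CoboundaryLaw : Prop :=
  ∀ {M R : Type} [CommMonoid M] [CommRing R] (η : M →* R) (f : M → R),
    (∀ a b, f (a * b) = f b + η b * f a) →
    (∃ b₀, IsUnit (η b₀ - 1)) →
    ∃ κ : R, ∀ a, f a = κ * (η a - 1)

theorem coboundaryLaw : CoboundaryLaw := by
  intro M R _ _ η f hf hb
  obtain ⟨b₀, u, hu⟩ := hb
  refine ⟨f b₀ * ↑u⁻¹, fun a => ?_⟩
  have h1 := hf a b₀
  have h2 := hf b₀ a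
  rw [mul_comm a b₀] at h1
  -- f b₀ + η b₀ * f a = f a + η a * f b₀
  have key : f a * (η b₀ - 1) = f b₀ * (η a - 1) := by
    have := h1.symm.trans h2
    linear_combination this
  have hinv : (η b₀ - 1) * ↑u⁻¹ = 1 := by rw [← hu, Units.mul_inv]
  calc f a = f a * ((η b₀ - 1) * ↑u⁻¹) := by rw [hinv, mul_one]
    _ = (f a * (η b₀ - 1)) * ↑u⁻¹ := by ring
    _ = (f b₀ * (η a - 1)) * ↑u⁻¹ := by rw [key]
    _ = f b₀ * ↑u⁻¹ * (η a - 1) := by ring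

/-- Operator coboundary law (all jet orders): with a commuting family of linear operators `ρ a`
(a monoid hom into `Module.End R V`), a twisted-symmetric cocycle `F (a*b) = F b + η b • ρ b (F a)`
is `F a = (η a • ρ a - 1) G` for one class vector `G`, provided some `η b₀ • ρ b₀ - 1` is a unit. -/
def OperatorCoboundaryLaw : Prop :=
  ∀ {M R V : Type} [CommMonoid M] [CommRing R] [AddCommGroup V] [Module R V]
    (η : M →* R) (ρ : M →* Module.End R V) (F : M → V),
    (∀ a b, F (a * b) = F b + η b • ρ b (F a)) →
    (∃ b₀, IsUnit (η b₀ • ρ b₀ - 1 : Module.End R V)) →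
    ∃ G : V, ∀ a, F a = (η a • ρ a - 1 : Module.End R V) G

theorem operatorCoboundaryLaw : OperatorCoboundaryLaw := by
  intro M R V _ _ _ _ η ρ F hF hb
  obtain ⟨b₀, u, hu⟩ := hb
  -- the operators V a := η a • ρ a - 1 commute pairwise
  have hcomm : ∀ a b : M, (η a • ρ a - 1 : Module.End R V) * (η b • ρ b - 1) =
      (η b • ρ b - 1) * (η a • ρ a - 1) := by
    intro a b
    have hρ : Commute (ρ a) (ρ b) := by
      show ρ a * ρ b = ρ b * ρ a
      rw [← map_mul, ← map_mul, mul_comm]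
    have h1 : Commute (η a • ρ a) (η b • ρ b) := (hρ.smul_left (η a)).smul_right (η b)
    exact ((h1.sub_left (Commute.one_left _)).sub_right (Commute.one_right _)).eq
  -- key identity: V b₀ (F a) = V a (F b₀)
  have key : ∀ a, (η b₀ • ρ b₀ - 1 : Module.End R V) (F a) = (η a • ρ a - 1 : Module.End R V) (F b₀) := by
    intro a
    have h1 := hF a b₀
    have h2 := hF b₀ a
    rw [mul_comm a b₀] at h1
    have h := h1.symm.trans h2
    -- F b₀ + η b₀ • ρ b₀ (F a) = F a + η a • ρ a (F b₀)
    simp only [LinearMap.sub_apply, LinearMap.smul_apply, Module.End.one_apply]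
    rw [sub_eq_sub_iff_add_eq_add, add_comm (η b₀ • (ρ b₀) (F a)), add_comm (η a • (ρ a) (F b₀))]
    exact h
  refine ⟨(↑u⁻¹ : Module.End R V) (F b₀), fun a => ?_⟩
  -- F a = u⁻¹ (u (F a)) = u⁻¹ (V a (F b₀)) = V a (u⁻¹ (F b₀)) by commutation
  have hc : Commute (η a • ρ a - 1 : Module.End R V) ↑u := by
    show _ * _ = _ * _
    rw [hu]; exact hcomm a b₀
  have hVa_uinv : (η a • ρ a - 1 : Module.End R V) * ↑u⁻¹ = ↑u⁻¹ * (η a • ρ a - 1) :=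
    hc.units_inv_right.eq
  calc F a = ((↑u⁻¹ : Module.End R V) * ↑u) (F a) := by rw [Units.inv_mul]; rfl
    _ = (↑u⁻¹ : Module.End R V) ((η b₀ • ρ b₀ - 1 : Module.End R V) (F a)) := by
          rw [Module.End.mul_apply, hu]
    _ = (↑u⁻¹ : Module.End R V) ((η a • ρ a - 1 : Module.End R V) (F b₀)) := by rw [key]
    _ = ((↑u⁻¹ : Module.End R V) * (η a • ρ a - 1)) (F b₀) := rfl
    _ = ((η a • ρ a - 1 : Module.End R V) * ↑u⁻¹) (F b₀) := by rw [hVa_uinv]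
    _ = (η a • ρ a - 1 : Module.End R V) ((↑u⁻¹ : Module.End R V) (F b₀)) := rfl

end Summit.BirchSwinnertonDyer.BirchSwinnertonDyer.Cruxes.SignedMuSeedAtTwoPlus.SmoothingCoboundary
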